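import Mathlib
import Literature.NumberTheory.EllipticCurves.Smith2016.CongruentNumberGenusDeterminantBlocks
import Literature.NumberTheory.EllipticCurves.Smith2016.CongruentNumberGenusDeterminantRowOne

/-!
# Smith 2016, Theorem 2.2 row 1, PROVED for every number of prime factors: `smith_thm22_rowOne_holds`

A. Smith, *The congruent numbers have positive natural density*, arXiv:1603.08479, Thm. 2.2 row 1
[Smith2016CongruentDensity]: for `n = p₁⋯p_k ≡ 1 (mod 8)` square-free,
`ℒ₁(n) = Σ_{n = d₀⋯d_ℓ, dᵢ ≡ 1 (8)} ∏ g(dᵢ) = det M₁` in `𝔽₂`.  The named fact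
`smith_thm22_rowOne` (`CongruentNumberGenusDeterminantRowOne`) is DISCHARGED here, for all `k`:
* `CongruentNumberGenusDeterminantForest`: `det M₁ = Σ_{π ∈ Partitions(Fin k)} ∏_{B} (1 + z_B) q_z(A^B)`
  (the bipartite all-minors forest formula, [Chaiken1982] over `𝔽₂`);
* `CongruentNumberGenusDeterminantBlocks`: `(1 + z_B) q_z(A^B) = [d_B ≡ 1 (8)] · g(d_B)`;
* this file: the dictionary between Tian–Yuan–Zhang's decompositions `n = d₀⋯d_ℓ` of the square-free
  `n` (`decompositions`, [TianYuanZhang2017, Thm. 1.1]) and the set partitions of the prime indices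
  (`sum_decompositions_eq_setExp`: the decomposition sum satisfies the block-of-the-least-prime
  recursion of `setExp` — Smith's own recursion (eq:n1rec) "if `p` is any prime divisor of `n`,
  `ℒ(n) = Σ_{p ∣ d ∣ n} g(d) ℒ(n/d)`" [Smith2016CongruentDensity, §2 Definition (chunk p0005 L34–L44)]),
  and the remark that for `n ≡ 1 (8)` a decomposition with at most one factor `≢ 1 (8)` has none.
Consequences already in the tree relative to the named fact become unconditional (see
`CongruentNumberGenusDeterminantConsequences`: Tian–Yuan–Zhang's Theorem 1.2 on `n ≡ 1 (8)` for
every `k`, `rank E_n(ℚ) = 0 ∧ Ш(E_n)[2^∞] = 0 ⟺ Σ∏g(dᵢ) odd`, with no L-function).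
-/

namespace Literature.NumberTheory.EllipticCurves.Smith2016

open _root_.Matrix Finset Literature.LinearAlgebra.Matrix Literature.Combinatorics.Enumerative
open Literature.NumberTheory.EllipticCurves.HeathBrown1994
open Literature.NumberTheory.EllipticCurves.TianYuanZhang2017

variable {k : ℕ} (p : Fin k → ℕ)

section SquarefreeBlocks

/-- A prime of the tuple divides a block product iff its index is in the block.
[cite: Smith2016CongruentDensity, §2.1 Remark 2.3 ("if d = p_{i₁}⋯p_{i_{r'}} is a divisor of the odd part of n")] -/
theorem prime_dvd_blockProd_iff (hp : ∀ i, (p i).Prime) (hinj : Function.Injective p)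
    (X : Finset (Fin k)) (i : Fin k) : p i ∣ ∏ j ∈ X, p j ↔ i ∈ X := by
  constructor
  · intro h
    obtain ⟨j, hj, hij⟩ := (Nat.Prime.prime (hp i)).exists_mem_finset_dvd h
    rwa [hinj ((Nat.prime_dvd_prime_iff_eq (hp i) (hp j)).mp hij)]
  · intro h; exact dvd_prod_of_mem p h

/-- Disjoint blocks have coprime products. [cite: Smith2016CongruentDensity, §2.1 Remark 2.3] -/
theorem coprime_blockProd (hp : ∀ i, (p i).Prime) (hinj : Function.Injective p)
    {X Y : Finset (Fin k)} (hXY : Disjoint X Y) : Nat.Coprime (∏ i ∈ X, p i) (∏ j ∈ Y, p j) := by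
  refine Nat.coprime_prod_left_iff.mpr fun i hi => Nat.coprime_prod_right_iff.mpr fun j hj => ?_
  rw [Nat.coprime_primes (hp i) (hp j)]
  exact fun h => disjoint_left.mp hXY hi ((hinj h) ▸ hj)

/-- A divisor of a block product is the product of the primes of the block dividing it.
[cite: Smith2016CongruentDensity, §2.1 Remark 2.3] -/
theorem eq_blockProd_filter_of_dvd (hp : ∀ i, (p i).Prime) (hinj : Function.Injective p)
    (X : Finset (Fin k)) {d : ℕ} (hd : d ∣ ∏ i ∈ X, p i) :
    d = ∏ i ∈ X.filter (fun i => p i ∣ d), p i := by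
  induction X using Finset.induction_on generalizing d with
  | empty =>
    rw [prod_empty] at hd
    rw [Nat.dvd_one.mp hd, filter_empty, prod_empty]
  | insert j X hjX ih =>
    rw [prod_insert hjX] at hd
    by_cases hjd : p j ∣ d
    · obtain ⟨d', rfl⟩ := hjd
      have hd' : d' ∣ ∏ i ∈ X, p i := Nat.dvd_of_mul_dvd_mul_left (hp j).pos hd
      have hfilt : (insert j X).filter (fun i => p i ∣ p j * d') =
          insert j (X.filter (fun i => p i ∣ d')) := by
        rw [filter_insert, if_pos (dvd_mul_right _ _)]
        congr 1
        refine filter_congr fun i hi => ?_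
        constructor
        · intro h
          rcases (Nat.Prime.prime (hp i)).dvd_or_dvd h with h1 | h1
          · exact absurd (hinj ((Nat.prime_dvd_prime_iff_eq (hp i) (hp j)).mp h1) ▸ hi) hjX
          · exact h1
        · intro h; exact dvd_mul_of_dvd_right h _
      rw [hfilt, prod_insert (fun h => hjX (mem_of_mem_filter _ h)), ← ih hd']
    · have hcop : Nat.Coprime d (p j) :=
        (Nat.Coprime.symm ((Nat.Prime.coprime_iff_not_dvd (hp j)).mpr hjd))
      have hd' : d ∣ ∏ i ∈ X, p i := hcop.dvd_mul_left.mp hd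
      have hgoal := ih hd'
      rw [filter_insert, if_neg hjd]
      exact hgoal

/-- Block products are positive. [cite: Smith2016CongruentDensity, §2.1 Remark 2.3] -/
theorem blockProd_pos (hp : ∀ i, (p i).Prime) (X : Finset (Fin k)) : 0 < ∏ i ∈ X, p i :=
  prod_pos fun i _ => (hp i).pos

/-- Unfolding membership in `decompositions`. [cite: TianYuanZhang2017, Thm. 1.1 ("non-ordered decompositions with dᵢ > 1")] -/
theorem mem_decompositions_iff {n : ℕ} {D : Finset ℕ} :
    D ∈ decompositions n ↔ D ⊆ n.divisors ∧ (∀ d ∈ D, 1 < d) ∧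
      (D : Set ℕ).Pairwise Nat.Coprime ∧ ∏ d ∈ D, d = n := by
  simp only [decompositions, mem_filter, mem_powerset]

/-- **Structure of a decomposition of a block product along a prime `p_m`**: there is a unique
factor `d₀` divisible by `p_m`; it is the product of the primes of `S` dividing it, and removing it
leaves a decomposition of the complementary block product.
[cite: Smith2016CongruentDensity, §2 Definition of ℒ, (eq:n1rec) (chunk p0005 L34–L44)] -/
theorem decomposition_blockProd_structure (hp : ∀ i, (p i).Prime) (hinj : Function.Injective p)
    {S : Finset (Fin k)} {m : Fin k} (hm : m ∈ S) {D : Finset ℕ}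
    (hD : D ∈ decompositions (∏ i ∈ S, p i)) :
    ∃ d₀ ∈ D, p m ∣ d₀ ∧ (∀ d ∈ D, p m ∣ d → d = d₀) ∧
      d₀ = ∏ i ∈ insert m ((S.erase m).filter (fun i => p i ∣ d₀)), p i ∧
      (∏ i ∈ S, p i) = d₀ * ∏ i ∈ (S.erase m) \ ((S.erase m).filter (fun i => p i ∣ d₀)), p i ∧
      D.erase d₀ ∈ decompositions (∏ i ∈ (S.erase m) \ ((S.erase m).filter (fun i => p i ∣ d₀)), p i) := by
  obtain ⟨hsub, hgt, hcop, hprod⟩ := mem_decompositions_iff.mp hD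
  have hpm : p m ∣ ∏ d ∈ D, d := by rw [hprod]; exact dvd_prod_of_mem p hm
  obtain ⟨d₀, hd₀, hmd₀⟩ := (Nat.Prime.prime (hp m)).exists_mem_finset_dvd hpm
  have huniq : ∀ d ∈ D, p m ∣ d → d = d₀ := by
    intro d hd hmd
    by_contra hne
    have hc : Nat.Coprime d d₀ := hcop hd hd₀ hne
    have : p m ∣ Nat.gcd d d₀ := Nat.dvd_gcd hmd hmd₀
    rw [hc] at this
    exact (hp m).one_lt.ne' (Nat.dvd_one.mp this)
  have hd₀n : d₀ ∣ ∏ i ∈ S, p i := by rw [← hprod]; exact dvd_prod_of_mem _ hd₀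
  have hd₀eq : d₀ = ∏ i ∈ S.filter (fun i => p i ∣ d₀), p i :=
    eq_blockProd_filter_of_dvd p hp hinj S hd₀n
  have hfilt : S.filter (fun i => p i ∣ d₀) = insert m ((S.erase m).filter (fun i => p i ∣ d₀)) := by
    conv_lhs => rw [← insert_erase hm]
    rw [filter_insert, if_pos hmd₀]
  have hfilt' : S.filter (fun i => ¬ p i ∣ d₀) = (S.erase m) \ ((S.erase m).filter (fun i => p i ∣ d₀)) := by
    ext i
    simp only [mem_filter, mem_sdiff, mem_erase, ne_eq]
    constructor
    · rintro ⟨hi, hnd⟩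
      exact ⟨⟨fun h => hnd (h ▸ hmd₀), hi⟩, fun h => hnd h.2⟩
    · rintro ⟨⟨hne, hi⟩, h⟩
      exact ⟨hi, fun hd => h ⟨⟨hne, hi⟩, hd⟩⟩
  have hsplit : (∏ i ∈ S, p i) = d₀ * ∏ i ∈ (S.erase m) \ ((S.erase m).filter (fun i => p i ∣ d₀)), p i := by
    rw [← prod_filter_mul_prod_filter_not S (fun i => p i ∣ d₀), ← hd₀eq, hfilt']
  refine ⟨d₀, hd₀, hmd₀, huniq, by rw [← hfilt]; exact hd₀eq, hsplit, ?_⟩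
  -- the remaining factors decompose the complementary block product
  set T := (S.erase m) \ ((S.erase m).filter (fun i => p i ∣ d₀)) with hT
  have hprod' : ∏ d ∈ D.erase d₀, d = ∏ i ∈ T, p i := by
    have h := mul_prod_erase D (fun d => d) hd₀
    rw [hprod, hsplit] at h
    exact Nat.eq_of_mul_eq_mul_left (lt_of_lt_of_le (hp m).pos (Nat.le_of_dvd
      (lt_trans zero_lt_one (hgt d₀ hd₀)) hmd₀)) h
  refine mem_decompositions_iff.mpr ⟨fun d hd => ?_, fun d hd => hgt d (mem_of_mem_erase hd),
    hcop.mono (by intro x hx; exact mem_of_mem_erase (mem_coe.mp hx)), hprod'⟩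
  rw [Nat.mem_divisors]
  exact ⟨hprod' ▸ dvd_prod_of_mem _ hd, (blockProd_pos p hp T).ne'⟩

/-- **Adjoining a block containing `p_m`** to a decomposition of the complementary block product
gives a decomposition of the whole block product.
[cite: Smith2016CongruentDensity, §2 Definition of ℒ, (eq:n1rec) (chunk p0005 L34–L44)] -/
theorem insert_blockProd_mem_decompositions (hp : ∀ i, (p i).Prime) (hinj : Function.Injective p)
    {S : Finset (Fin k)} {m : Fin k} (hm : m ∈ S) {B : Finset (Fin k)} (hB : B ⊆ S.erase m)
    {D' : Finset ℕ} (hD' : D' ∈ decompositions (∏ i ∈ (S.erase m) \ B, p i)) :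
    (∏ i ∈ insert m B, p i) ∉ D' ∧ (∀ d ∈ D', ¬ p m ∣ d) ∧
      insert (∏ i ∈ insert m B, p i) D' ∈ decompositions (∏ i ∈ S, p i) := by
  obtain ⟨hsub, hgt, hcop, hprod⟩ := mem_decompositions_iff.mp hD'
  set a := ∏ i ∈ insert m B, p i with ha
  set T := (S.erase m) \ B with hT
  have hmB : m ∉ B := fun h => notMem_erase m S (hB h)
  have hdisj : Disjoint (insert m B) T := by
    rw [disjoint_insert_left]
    exact ⟨fun h => notMem_erase m S (mem_sdiff.mp h).1, disjoint_sdiff⟩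
  have hcopaT : Nat.Coprime a (∏ i ∈ T, p i) := coprime_blockProd p hp hinj hdisj
  have hnS : (∏ i ∈ S, p i) = a * ∏ i ∈ T, p i := by
    rw [ha, hT, prod_insert hmB, ← mul_prod_erase S p hm, ← prod_sdiff hB]
    ring
  have ha1 : 1 < a := by
    rw [ha, prod_insert hmB]
    exact lt_of_lt_of_le (hp m).one_lt (Nat.le_mul_of_pos_right _ (blockProd_pos p hp B))
  have hdvd' : ∀ d ∈ D', d ∣ ∏ i ∈ T, p i := fun d hd => hprod ▸ dvd_prod_of_mem _ hd
  have haD' : a ∉ D' := fun h => ha1.ne' (Nat.Coprime.eq_one_of_dvd hcopaT (hdvd' a h))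
  have hpmT : ¬ p m ∣ ∏ i ∈ T, p i := by
    rw [prime_dvd_blockProd_iff p hp hinj]
    exact fun h => notMem_erase m S (mem_sdiff.mp h).1
  refine ⟨haD', fun d hd hmd => hpmT (hmd.trans (hdvd' d hd)), mem_decompositions_iff.mpr
    ⟨fun d hd => ?_, fun d hd => ?_, ?_, ?_⟩⟩
  · rw [Nat.mem_divisors]
    refine ⟨?_, (blockProd_pos p hp S).ne'⟩
    rcases mem_insert.mp hd with rfl | hd
    · exact ⟨_, hnS⟩
    · exact (hdvd' d hd).trans ⟨a, by rw [hnS, mul_comm]⟩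
  · rcases mem_insert.mp hd with rfl | hd
    · exact ha1
    · exact hgt d hd
  · rw [coe_insert, Set.pairwise_insert]
    refine ⟨hcop, fun d hd hne => ?_⟩
    have h := Nat.Coprime.coprime_dvd_right (hdvd' d hd) hcopaT
    exact ⟨h, h.symm⟩
  · rw [prod_insert haD', hprod, hnS]

/-- **The decomposition sum satisfies the block-of-a-prime recursion** (Smith's (eq:n1rec) in
product form): grouping the decompositions of `∏_S pᵢ` by the factor containing `p_m`.
[cite: Smith2016CongruentDensity, §2 Definition of ℒ, (eq:n1rec) (chunk p0005 L34–L44)] -/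
theorem sum_decompositions_blockProd_rec {R : Type*} [CommSemiring R] (hp : ∀ i, (p i).Prime)
    (hinj : Function.Injective p) (w : ℕ → R) {S : Finset (Fin k)} {m : Fin k} (hm : m ∈ S) :
    ∑ D ∈ decompositions (∏ i ∈ S, p i), ∏ d ∈ D, w d =
      ∑ B ∈ (S.erase m).powerset, w (∏ i ∈ insert m B, p i) *
        ∑ D ∈ decompositions (∏ i ∈ (S.erase m) \ B, p i), ∏ d ∈ D, w d := by
  simp_rw [mul_sum]
  rw [← sum_sigma ((S.erase m).powerset) (fun B => decompositions (∏ i ∈ (S.erase m) \ B, p i))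
    (fun x => w (∏ i ∈ insert m x.1, p i) * ∏ d ∈ x.2, w d)]
  refine sum_bij'
    (fun D _ => ⟨(S.erase m).filter (fun i => p i ∣ ∏ d ∈ D.filter (fun d => p m ∣ d), d),
      D.filter (fun d => ¬ p m ∣ d)⟩)
    (fun x _ => insert (∏ i ∈ insert m x.1, p i) x.2) ?_ ?_ ?_ ?_ ?_
  · -- `i` lands in the sigma set
    intro D hD
    obtain ⟨d₀, hd₀, hmd₀, huniq, hd₀eq, _, hrest⟩ := decomposition_blockProd_structure p hp hinj hm hD
    have hF : D.filter (fun d => p m ∣ d) = {d₀} :=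
      eq_singleton_iff_unique_mem.mpr ⟨mem_filter.mpr ⟨hd₀, hmd₀⟩,
        fun d hd => huniq d (mem_of_mem_filter _ hd) (mem_filter.mp hd).2⟩
    have hE : D.filter (fun d => ¬ p m ∣ d) = D.erase d₀ := by
      ext d
      simp only [mem_filter, mem_erase, ne_eq]
      constructor
      · rintro ⟨hd, hnd⟩; exact ⟨fun h => hnd (h ▸ hmd₀), hd⟩
      · rintro ⟨hne, hd⟩; exact ⟨hd, fun h => hne (huniq d hd h)⟩
    rw [mem_sigma, mem_powerset, hF, prod_singleton, hE]
    exact ⟨filter_subset _ _, hrest⟩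
  · -- `j` lands in the decompositions
    intro x hx
    rw [mem_sigma, mem_powerset] at hx
    exact (insert_blockProd_mem_decompositions p hp hinj hm hx.1 hx.2).2.2
  · -- left inverse
    intro D hD
    obtain ⟨d₀, hd₀, hmd₀, huniq, hd₀eq, _, _⟩ := decomposition_blockProd_structure p hp hinj hm hD
    have hF : D.filter (fun d => p m ∣ d) = {d₀} :=
      eq_singleton_iff_unique_mem.mpr ⟨mem_filter.mpr ⟨hd₀, hmd₀⟩,
        fun d hd => huniq d (mem_of_mem_filter _ hd) (mem_filter.mp hd).2⟩
    have hE : D.filter (fun d => ¬ p m ∣ d) = D.erase d₀ := by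
      ext d
      simp only [mem_filter, mem_erase, ne_eq]
      constructor
      · rintro ⟨hd, hnd⟩; exact ⟨fun h => hnd (h ▸ hmd₀), hd⟩
      · rintro ⟨hne, hd⟩; exact ⟨hd, fun h => hne (huniq d hd h)⟩
    simp only [hF, prod_singleton, hE]
    rw [← hd₀eq, insert_erase hd₀]
  · -- right inverse
    rintro ⟨B, D'⟩ hx
    rw [mem_sigma, mem_powerset] at hx
    obtain ⟨haD', hnot, _⟩ := insert_blockProd_mem_decompositions p hp hinj hm hx.1 hx.2
    have hmB : m ∉ B := fun h => notMem_erase m S (hx.1 h)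
    have hF : (insert (∏ i ∈ insert m B, p i) D').filter (fun d => p m ∣ d) =
        {∏ i ∈ insert m B, p i} := by
      rw [filter_insert, if_pos (dvd_prod_of_mem p (mem_insert_self m B)),
        filter_false_of_mem (fun d hd => hnot d hd), insert_empty]
    have hE : (insert (∏ i ∈ insert m B, p i) D').filter (fun d => ¬ p m ∣ d) = D' := by
      rw [filter_insert, if_neg (not_not.mpr (dvd_prod_of_mem p (mem_insert_self m B))),
        filter_true_of_mem (fun d hd => hnot d hd)]
    have hB' : (S.erase m).filter (fun i => p i ∣ ∏ j ∈ insert m B, p j) = B := by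
      ext i
      rw [mem_filter, prime_dvd_blockProd_iff p hp hinj, mem_insert, mem_erase]
      constructor
      · rintro ⟨⟨hne, _⟩, h⟩
        exact h.resolve_left hne
      · intro h; exact ⟨⟨fun h' => hmB (h' ▸ h), (mem_of_mem_erase (hx.1 h))⟩, Or.inr h⟩
    simp only [hF, prod_singleton, hE, hB']
  · -- the summands agree
    intro D hD
    obtain ⟨d₀, hd₀, hmd₀, huniq, hd₀eq, _, _⟩ := decomposition_blockProd_structure p hp hinj hm hD
    have hF : D.filter (fun d => p m ∣ d) = {d₀} :=
      eq_singleton_iff_unique_mem.mpr ⟨mem_filter.mpr ⟨hd₀, hmd₀⟩,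
        fun d hd => huniq d (mem_of_mem_filter _ hd) (mem_filter.mp hd).2⟩
    have hE : D.filter (fun d => ¬ p m ∣ d) = D.erase d₀ := by
      ext d
      simp only [mem_filter, mem_erase, ne_eq]
      constructor
      · rintro ⟨hd, hnd⟩; exact ⟨fun h => hnd (h ▸ hmd₀), hd⟩
      · rintro ⟨hne, hd⟩; exact ⟨hd, fun h => hne (huniq d hd h)⟩
    simp only [hF, prod_singleton, hE]
    rw [← hd₀eq, mul_prod_erase D w hd₀]

/-- **Decompositions of a square-free number ↔ set partitions of its prime indices**: for any weight
`w`, `Σ_{D ∈ decompositions (∏_S pᵢ)} ∏_{d∈D} w d = setExp (B ↦ w (∏_B pᵢ)) S`.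
[cite: Smith2016CongruentDensity, §2 Definition of ℒ ("Unrolled: ℒ(n) = Σ ∏ g(dᵢ) over the non-ordered decompositions")] [cite: TianYuanZhang2017, Thm. 1.1] -/
theorem sum_decompositions_eq_setExp {R : Type*} [CommSemiring R] (hp : ∀ i, (p i).Prime)
    (hinj : Function.Injective p) (w : ℕ → R) (S : Finset (Fin k)) :
    ∑ D ∈ decompositions (∏ i ∈ S, p i), ∏ d ∈ D, w d =
      setExp (fun B => w (∏ i ∈ B, p i)) S := by
  suffices H : ∀ (n : ℕ) (S : Finset (Fin k)), S.card = n →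
      ∑ D ∈ decompositions (∏ i ∈ S, p i), ∏ d ∈ D, w d =
        setExp (fun B => w (∏ i ∈ B, p i)) S from H _ S rfl
  intro n
  induction n using Nat.strong_induction_on with
  | _ n ih =>
  intro S hn
  by_cases hS : S.Nonempty
  · rw [setExp_of_nonempty _ hS, sum_decompositions_blockProd_rec p hp hinj w (S.min'_mem hS)]
    refine sum_congr rfl fun B hB => ?_
    rw [ih _ (by
      rw [← hn]
      exact lt_of_le_of_lt (card_le_card sdiff_subset) (card_erase_lt_of_mem (S.min'_mem hS))) _ rfl]
  · rw [not_nonempty_iff_eq_empty] at hS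
    subst hS
    rw [prod_empty, setExp_empty]
    -- `decompositions 1 = {∅}`
    have h1 : decompositions 1 = {∅} := by
      ext D
      rw [mem_decompositions_iff, mem_singleton, Nat.divisors_one]
      constructor
      · rintro ⟨hsub, hgt, -, -⟩
        rw [eq_empty_iff_forall_notMem]
        intro d hd
        have := mem_singleton.mp (hsub hd)
        exact (hgt d hd).ne' this
      · rintro rfl
        simp
    rw [h1, sum_singleton, prod_empty]

end SquarefreeBlocks

section RowOne

/-- For `n ≡ 1 (mod 8)`, a decomposition of `n` with at most one factor `≢ 1 (mod 8)` has none.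
[cite: Smith2016CongruentDensity, §2 (the row `n ≡ 1 (8)` of Table 1: for n ≡ 1 (8) a decomposition with at most one factor ≢ 1 (8) has none)] -/
theorem forall_mod_eight_eq_one_of_card_le_one {n : ℕ} (hn : n % 8 = 1) {D : Finset ℕ}
    (hD : D ∈ decompositions n) (hcard : (D.filter fun d => d % 8 ≠ 1).card ≤ 1) :
    ∀ d ∈ D, d % 8 = 1 := by
  obtain ⟨-, -, -, hprod⟩ := mem_decompositions_iff.mp hD
  intro d₀ hd₀
  by_contra hd₀8
  have hmem : d₀ ∈ D.filter (fun d => d % 8 ≠ 1) := mem_filter.mpr ⟨hd₀, hd₀8⟩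
  have hF : {d₀} = D.filter (fun d => d % 8 ≠ 1) :=
    eq_of_subset_of_card_le (singleton_subset_iff.mpr hmem) (by rw [card_singleton]; exact hcard)
  have hothers : ∀ d ∈ D.erase d₀, d % 8 = 1 := by
    intro d hd
    by_contra h8
    have : d ∈ D.filter (fun d => d % 8 ≠ 1) := mem_filter.mpr ⟨mem_of_mem_erase hd, h8⟩
    rw [← hF, mem_singleton] at this
    exact ne_of_mem_erase hd this
  have hrest : (∏ d ∈ D.erase d₀, d) % 8 = 1 := by
    rw [Finset.prod_nat_mod, prod_congr rfl fun d hd => hothers d hd, prod_const_one]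
    rfl
  have h := mul_prod_erase D (fun d => d) hd₀
  rw [hprod] at h
  have : n % 8 = d₀ % 8 := by
    rw [← h, Nat.mul_mod, hrest, mul_one, Nat.mod_mod]
  exact hd₀8 (this ▸ hn)

/-- For `n ≡ 1 (mod 8)`, the first genus sum in `𝔽₂` is the decomposition sum of the weight
`[d ≡ 1 (8)]·g(d)`. [cite: Smith2016CongruentDensity, §2 Definition of ℒ (chunk p0005 L34–L44)] [cite: TianYuanZhang2017, Thm. 1.1] -/
theorem natCast_genusSum₁_eq_sum_decompositions {n : ℕ} (hn : n % 8 = 1) (g : ℕ → ℕ) :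
    ((genusSum₁ n g : ℕ) : ZMod 2) =
      ∑ D ∈ decompositions n, ∏ d ∈ D, (if d % 8 = 1 then ((g d : ℕ) : ZMod 2) else 0) := by
  unfold genusSum₁
  rw [Nat.cast_sum, sum_filter]
  refine sum_congr rfl fun D hD => ?_
  by_cases hc : (D.filter fun d => d % 8 ≠ 1).card ≤ 1
  · rw [if_pos hc, Nat.cast_prod]
    refine prod_congr rfl fun d hd => ?_
    rw [if_pos (forall_mod_eight_eq_one_of_card_le_one hn hD hc d hd)]
  · rw [if_neg hc]
    by_cases hex : ∃ d ∈ D, d % 8 ≠ 1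
    · obtain ⟨d, hd, hd8⟩ := hex
      exact (prod_eq_zero hd (if_neg hd8)).symm
    · exfalso
      apply hc
      rw [filter_false_of_mem (fun d hd h8 => hex ⟨d, hd, h8⟩), card_empty]
      exact zero_le_one

/-- **Smith 2016, Theorem 2.2, row 1 — PROVED for every `k`**: for `n = p₁⋯p_k ≡ 1 (mod 8)` a product
of distinct odd primes, `ℒ₁(n) = Σ_{n = d₀⋯d_ℓ, dᵢ ≡ 1 (8)} ∏ᵢ g(dᵢ) ≡ det M₁ (mod 2)`,
`M₁ = [[A + Aᵀ, Aᵀ],[A, D_z]]`: the named fact `smith_thm22_rowOne` discharged.  Proof: the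
bipartite all-minors forest formula (`det_smithMatrixOne_eq_setExp`), the block dictionary
(`blockWeight_eq_genusWeight`) and the decomposition ↔ partition dictionary above.
[cite: Smith2016CongruentDensity, Thm. 2.2 row 1 / Prop. 2.4 (arXiv:1603.08479 §2, chunk p0005 L59–L63, p0006 L13–L34)] -/
theorem smith_thm22_rowOne_holds : smith_thm22_rowOne := by
  intro k p hp hodd hinj h8
  have hn1 : (∏ i ∈ (univ : Finset (Fin k)), p i) % 8 = 1 := h8
  rw [det_smithMatrixOne_eq_setExp, natCast_genusSum₁_eq_sum_decompositions h8,
    show (∏ i, p i) = ∏ i ∈ (univ : Finset (Fin k)), p i from rfl,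
    sum_decompositions_eq_setExp p hp hinj _ univ]
  refine setExp_congr fun B _ hB => ?_
  rw [blockWeight_eq_genusWeight p hp hodd hinj hB]

end RowOne

end Literature.NumberTheory.EllipticCurves.Smith2016
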